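import Mathlib
import Summits.NavierStokesRegularity.NavierStokesRegularity.Theorems.EulerZoomLiouvillePowerGaugeEulerLiouvilleCondenserMinimalTypePast
import Summits.NavierStokesRegularity.NavierStokesRegularity.Theorems.EulerZoomLiouvillePowerGaugeEulerLiouvilleSelfSimilarIrrotationalGrowth
import Summits.NavierStokesRegularity.NavierStokesRegularity.Theorems.EulerZoomLiouvillePowerGaugeEulerLiouvilleSelfSimilarShiftedUniformlyContinuous

/-!
# A CLASS-FREE LIOUVILLE THEOREM: a `C²` self-similar Euler profile with the two power budgets and MINIMAL LOWER GRADIENT TYPE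
# at the critical order `2+ρ` is ZERO (KEY «C-MIN» at profile level; for the W8/D1 «formal far-field family» arena)

Width piece for crux `EulerZoomLiouville.PowerGaugeEulerLiouville` (stmt-NavierStokesRegularity-19832), by name under
LEAD 19832 (ns-typeII-p2 g12); seat ns-ezl-w2 g3, `--supports stmt-NavierStokesRegularity-19832 --as helper`.

**`eq_zero_of_minimalTypeGradient_selfSimilarProfile`** — `(V, P')` a self-similar Euler profile with clock `1/(2+ρ)`,
`0 < ρ ≤ ½`, closed-ball budgets `∫⁻_{B̄_L}‖V‖² ≤ c_A L^{1−2ρ}`, `∫⁻_{B̄_L}‖DV‖² ≤ c_E L^{1−ρ}` (`L ≥ 1`) and minimal lower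
exponential type of `‖DV‖` at order `2+ρ` (`∀ c' > 0, ∀ R₀, ∃ R ≥ R₀, sup_{B(0,3R)}‖DV‖ ≤ e^{c'R^{2+ρ}}`) ⇒ `V = 0`.
No member, no class: the statement for candidate profile families (parallel to ns-ezl-w3 g4's axisymmetric Liouville).
Route: `Condenser.curl_eq_zero_of_minimalTypeGradient` (KEY «C-MIN» core) ⇒ irrotational; `Shifted.growth_of_growth_two_le` +
`Loc.eq_zero_of_curl_eq_zero_of_growth` (harmonic Liouville under `L^{1−2ρ}` growth).

HONEST FRAMING: a Liouville theorem about HYPOTHETICAL self-similar Euler profiles; nothing here proves the crux E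
`PowerGaugeEulerLiouville` (19832 OPEN), any door Target, or Navier–Stokes regularity; MODEL lattice only.
[cite: ConstantinIgnatovaVicol2026Putative, §3.4.1; folklore]
-/

noncomputable section

open Set Filter Topology Metric Function MeasureTheory Real
open scoped RealInnerProductSpace NNReal ENNReal

set_option linter.dupNamespace false

namespace Summit.NavierStokesRegularity.NavierStokesRegularity.Theorems.PowerGaugeEulerLiouville.Condenser

open Literature.Analysis Literature.Analysis.FluidPDE
open Summit.NavierStokesRegularity.NavierStokesRegularity.Theorems.PowerGaugeEulerLiouville

/-- **CLASS-FREE LIOUVILLE: power budgets + minimal lower gradient type at order `2+ρ` ⇒ the profile is zero.**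
See the module docstring. [cite: ConstantinIgnatovaVicol2026Putative, §3.4.1; folklore] -/
theorem eq_zero_of_minimalTypeGradient_selfSimilarProfile {ρ : ℝ} (hρ : 0 < ρ) (hρ1 : ρ ≤ 1 / 2)
    {V : EuclideanSpace ℝ (Fin 3) → EuclideanSpace ℝ (Fin 3)} {P' : EuclideanSpace ℝ (Fin 3) → ℝ}
    (hprof : IsSelfSimilarEulerProfile (1 / (2 + ρ)) 0 V P') {cA cE : ℝ} (hcA : 0 ≤ cA) (hcE : 0 ≤ cE)
    (hbA : ∀ L : ℝ, 1 ≤ L →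
      ∫⁻ z in closedBall (0 : EuclideanSpace ℝ (Fin 3)) L, ‖V z‖ₑ ^ 2 ≤ ENNReal.ofReal (cA * L ^ (1 - 2 * ρ)))
    (hbE : ∀ L : ℝ, 1 ≤ L →
      ∫⁻ z in closedBall (0 : EuclideanSpace ℝ (Fin 3)) L, ‖fderiv ℝ V z‖ₑ ^ 2 ≤ ENNReal.ofReal (cE * L ^ (1 - ρ)))
    (hgrad : ∀ c' : ℝ, 0 < c' → ∀ R₀ : ℝ, ∃ R : ℝ, R₀ ≤ R ∧
      ∀ z ∈ ball (0 : EuclideanSpace ℝ (Fin 3)) (3 * R), ‖fderiv ℝ V z‖ ≤ Real.exp (c' * R ^ (2 + ρ))) :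
    V = 0 := by
  have hV : ContDiff ℝ 2 V := hprof.isSelfSimilarEulerVorticityProfile.contDiff_velocity
  have hdiv : VectorCalculus.IsDivFree V := hprof.divFree
  -- real ball budgets at radius `3R`, `R ≥ 1`
  have hbA' : ∀ R : ℝ, 1 ≤ R →
      ∫ x in ball (0 : EuclideanSpace ℝ (Fin 3)) (3 * R), ‖V x‖ ^ 2 ≤ (cA + 1) * (3 * R) ^ (1 - 2 * ρ) := by
    intro R hR
    have h3R1 : (1 : ℝ) ≤ 3 * R := by linarith
    have h3R0 : (0 : ℝ) < 3 * R := by linarith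
    have h1 : ∫⁻ z in ball (0 : EuclideanSpace ℝ (Fin 3)) (3 * R), ‖V z‖ₑ ^ 2 ≤
        ENNReal.ofReal (cA * (3 * R) ^ (1 - 2 * ρ)) :=
      (lintegral_mono_set ball_subset_closedBall).trans (hbA (3 * R) h3R1)
    have hX : 0 ≤ (cA + 1) * (3 * R) ^ (1 - 2 * ρ) := by positivity
    refine setIntegral_sq_le_of_lintegral hV.continuous hX (h1.trans ?_)
    exact ENNReal.ofReal_le_ofReal (by nlinarith [Real.rpow_nonneg h3R0.le (1 - 2 * ρ)])
  have hbE' : ∀ R : ℝ, 1 ≤ R →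
      ∫ x in ball (0 : EuclideanSpace ℝ (Fin 3)) (3 * R), ‖fderiv ℝ V x‖ ^ 2 ≤ (cE + 1) * (3 * R) ^ (1 - ρ) := by
    intro R hR
    have h3R1 : (1 : ℝ) ≤ 3 * R := by linarith
    have h3R0 : (0 : ℝ) < 3 * R := by linarith
    have h1 : ∫⁻ z in ball (0 : EuclideanSpace ℝ (Fin 3)) (3 * R), ‖fderiv ℝ V z‖ₑ ^ 2 ≤
        ENNReal.ofReal (cE * (3 * R) ^ (1 - ρ)) :=
      (lintegral_mono_set ball_subset_closedBall).trans (hbE (3 * R) h3R1)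
    have hY : 0 ≤ (cE + 1) * (3 * R) ^ (1 - ρ) := by positivity
    refine setIntegral_sq_le_of_lintegral (hV.continuous_fderiv (by norm_num)) hY (h1.trans ?_)
    exact ENNReal.ofReal_le_ofReal (by nlinarith [Real.rpow_nonneg h3R0.le (1 - ρ)])
  -- irrotational by the KEY «C-MIN» core
  have hcurl : ∀ x, curl V x = 0 :=
    curl_eq_zero_of_minimalTypeGradient hρ hρ1 hprof hV (by linarith) (by linarith) hbA' hbE' hgrad
  -- harmonic Liouville under `L^{1−2ρ}` growth
  have hA2 : ∀ L : ℝ, 2 ≤ L → ∫⁻ y in ball (0 : EuclideanSpace ℝ (Fin 3)) L, ‖V y‖ₑ ^ 2 ≤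
      ENNReal.ofReal cA * ENNReal.ofReal (L ^ (1 - 2 * ρ)) := by
    intro L hL
    rw [← ENNReal.ofReal_mul hcA]
    exact (lintegral_mono_set ball_subset_closedBall).trans (hbA L (by linarith))
  obtain ⟨C', hC', hgr⟩ :=
    Shifted.growth_of_growth_two_le hV.continuous (θ := 1 - 2 * ρ) (by linarith) ENNReal.ofReal_ne_top hA2
  exact Loc.eq_zero_of_curl_eq_zero_of_growth hV hcurl hdiv hC' (θ := 1 - 2 * ρ) (by linarith) hgr

end Summit.NavierStokesRegularity.NavierStokesRegularity.Theorems.PowerGaugeEulerLiouville.Condenser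

end
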